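import Mathlib.GroupTheory.FreeGroup.NielsenSchreier
import Mathlib.GroupTheory.FreeGroup.CyclicallyReduced
import Mathlib.GroupTheory.SpecificGroups.Cyclic
import Mathlib.GroupTheory.Perm.Fin
import HarnessLib

/-!
# Centralizers in free groups are cyclic; maximal cyclic subgroups are malnormal

Topic `Literature/GroupTheory/CombinatorialGroupTheory`; theorems only (Mathlib `FreeGroup`,
`IsFreeGroup`, Nielsen–Schreier `subgroupIsFreeOfIsFree`, `IsMulTorsionFree (FreeGroup α)`).
Classical facts about a free group `F` (Magnus–Karrass–Solitar, *Combinatorial Group Theory*,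
§1.4 Problems 6–7 and Cor. 4.1.6; Lyndon–Schupp, *Combinatorial Group Theory*, Ch. I,
Props. 2.16–2.19):

* `IsFreeGroup.isCyclic_of_comm` — a free group all of whose elements commute is cyclic;
  `FreeGroup.isCyclic_of_forall_commute` — a commutative subgroup of a free group is cyclic;
* `FreeGroup.zpow_eq_of_iff` — a basis element is not a proper power;
* `IsFreeGroup.isCyclic_of_mem_center` — a free group with a non-trivial central element is cyclic;
* `FreeGroup.isCyclic_centralizer` — **the centralizer of a non-trivial element is cyclic**;
* `FreeGroup.commute_of_zpow_eq_zpow` — `xᵐ = yⁿ` with `m, n ≠ 0` forces `xy = yx`;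
* `FreeGroup.centralizer_zpow_eq_zpowers`, `FreeGroup.eq_zero_of_conj_zpow_mem_zpowers` — if `r` is
  not a proper power then `Z(rᵐ) = ⟨r⟩` (`m ≠ 0`) and **`⟨r⟩` is malnormal**:
  `g ∉ ⟨r⟩`, `g rᵐ g⁻¹ ∈ ⟨r⟩` force `m = 0`.

These are the free-factor inputs of the centralizer theorem for amalgams used for surface groups
(`S_g = F_{2g-2} *_ℤ F_2`).

## References

* W. Magnus, A. Karrass, D. Solitar, *Combinatorial Group Theory*, Interscience (1966), §1.4,
  §4.1. [MagnusKarrassSolitar1966]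
* R. C. Lyndon, P. E. Schupp, *Combinatorial Group Theory*, Springer (1977); Classics in
  Mathematics (2001), Ch. I §2. [LyndonSchupp2001]
-/

namespace Literature.GroupTheory.CombinatorialGroupTheory

open Subgroup

universe u

/-! ### Commutative free groups are cyclic -/

/-- Two distinct basis elements of a free group do not commute (seen in `S₃`; cf. the tree's
`Literature.IUT.HodgeTheaters.FreeOrSurface.of_mul_of_ne_comm`, not imported here to keep this
file Mathlib-only). [cite: LyndonSchupp2001, Ch. I Prop. 2.16] -/
private theorem IsFreeGroup.of_mul_of_ne {H : Type u} [Group H] [IsFreeGroup H]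
    {a b : IsFreeGroup.Generators H} (hab : a ≠ b) :
    IsFreeGroup.of a * IsFreeGroup.of b ≠ IsFreeGroup.of b * IsFreeGroup.of a := by
  classical
  let f : IsFreeGroup.Generators H → Equiv.Perm (Fin 3) := fun c =>
    if c = a then Equiv.swap 0 1 else if c = b then Equiv.swap 1 2 else 1
  have hfa : f a = Equiv.swap 0 1 := by simp [f]
  have hfb : f b = Equiv.swap 1 2 := by simp [f, Ne.symm hab]
  intro h
  have h' := congrArg (IsFreeGroup.lift f) h
  simp only [map_mul, IsFreeGroup.lift_of, hfa, hfb] at h'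
  exact absurd h' (by decide)

/-- Every element of a free group lies in the subgroup generated by the basis.
[cite: LyndonSchupp2001, Ch. I Prop. 1.1] -/
theorem IsFreeGroup.mem_closure_range_of {H : Type u} [Group H] [IsFreeGroup H] (x : H) :
    x ∈ Subgroup.closure (Set.range (IsFreeGroup.of (G := H))) := by
  have hx := (IsFreeGroup.toFreeGroup H).symm_apply_apply x
  rw [← hx]
  induction (IsFreeGroup.toFreeGroup H) x using FreeGroup.induction_on with
  | C1 => simp
  | of c =>
    have : (IsFreeGroup.toFreeGroup H).symm (FreeGroup.of c) = IsFreeGroup.of c := by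
      simp [IsFreeGroup.toFreeGroup, IsFreeGroup.of]
    rw [this]
    exact Subgroup.subset_closure ⟨c, rfl⟩
  | inv_of c hc => rw [map_inv]; exact Subgroup.inv_mem _ hc
  | mul p q hp hq => rw [map_mul]; exact Subgroup.mul_mem _ hp hq

/-- A free group whose basis has at most one element is cyclic. [cite: LyndonSchupp2001, Ch. I §2] -/
theorem IsFreeGroup.isCyclic_of_subsingleton_generators {H : Type u} [Group H] [IsFreeGroup H]
    (hs : Subsingleton (IsFreeGroup.Generators H)) : IsCyclic H := by
  rcases isEmpty_or_nonempty (IsFreeGroup.Generators H) with hE | ⟨⟨a⟩⟩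
  · refine ⟨⟨1, fun x => ⟨0, ?_⟩⟩⟩
    have hx := IsFreeGroup.mem_closure_range_of x
    rw [Set.range_eq_empty, Subgroup.closure_empty, Subgroup.mem_bot] at hx
    simp [hx]
  · refine ⟨⟨IsFreeGroup.of a, fun x => ?_⟩⟩
    have hx := IsFreeGroup.mem_closure_range_of x
    have hr : Set.range (IsFreeGroup.of (G := H)) = {IsFreeGroup.of a} := by
      ext y
      simp only [Set.mem_range, Set.mem_singleton_iff]
      constructor
      · rintro ⟨c, rfl⟩; rw [Subsingleton.elim c a]
      · rintro rfl; exact ⟨a, rfl⟩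
    rw [hr, ← Subgroup.zpowers_eq_closure, Subgroup.mem_zpowers_iff] at hx
    exact hx

/-- **A free group all of whose elements commute is cyclic** (it has at most one basis element).
[cite: MagnusKarrassSolitar1966, §1.4 Problem 6] -/
theorem IsFreeGroup.isCyclic_of_comm {H : Type u} [Group H] [IsFreeGroup H]
    (hc : ∀ a b : H, a * b = b * a) : IsCyclic H :=
  IsFreeGroup.isCyclic_of_subsingleton_generators
    (Subsingleton.intro fun a b =>
      Classical.byContradiction fun hab => IsFreeGroup.of_mul_of_ne (a := a) (b := b) hab (hc _ _))

/-- **A commutative subgroup of a free group is cyclic** (Nielsen–Schreier: it is free).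
[cite: LyndonSchupp2001, Ch. I Prop. 2.17] -/
theorem FreeGroup.isCyclic_of_forall_commute {α : Type u} (K : Subgroup (FreeGroup α))
    (hK : ∀ a ∈ K, ∀ b ∈ K, a * b = b * a) : IsCyclic K :=
  IsFreeGroup.isCyclic_of_comm fun a b => Subtype.ext (hK a a.2 b b.2)

/-! ### Basis elements are not proper powers -/

/-- The exponent-sum of the letter `a`: the homomorphism `F(α) → ℤ` with `a ↦ 1` and every other
letter `↦ 0`. [cite: LyndonSchupp2001, Ch. I §2] -/
theorem FreeGroup.exists_hom_of_eq_one {α : Type u} [DecidableEq α] (a : α) :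
    ∃ σ : FreeGroup α →* Multiplicative ℤ, σ (FreeGroup.of a) = Multiplicative.ofAdd 1 ∧
      ∀ b, b ≠ a → σ (FreeGroup.of b) = 1 :=
  ⟨FreeGroup.lift fun b => if b = a then Multiplicative.ofAdd 1 else 1, by simp, fun b hb => by
    simp [hb]⟩

/-- **A basis element of a free group is not a proper power**: `of a = t ^ k` forces `k = ±1`.
[cite: LyndonSchupp2001, Ch. I Prop. 2.17] -/
theorem FreeGroup.zpow_eq_of_iff {α : Type u} (a : α) (t : FreeGroup α) (k : ℤ)
    (h : t ^ k = FreeGroup.of a) : k = 1 ∨ k = -1 := by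
  classical
  obtain ⟨σ, hσa, -⟩ := FreeGroup.exists_hom_of_eq_one a
  have h1 := congrArg σ h
  rw [map_zpow, hσa] at h1
  have h2 := congrArg Multiplicative.toAdd h1
  rw [toAdd_zpow, toAdd_ofAdd, smul_eq_mul] at h2
  rcases Int.eq_one_or_neg_one_of_mul_eq_one h2 with hk | hk
  · exact Or.inl hk
  · exact Or.inr hk

/-- If a cyclic subgroup `⟨t⟩` contains an element `r` which is not a proper power
(`t ^ k = r ⇒ k = ±1`), then `⟨t⟩ = ⟨r⟩`. [cite: MagnusKarrassSolitar1966, §1.4 Problem 7] -/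
theorem zpowers_eq_zpowers_of_prim {G : Type u} [Group G] {r t : G}
    (hr : ∀ k : ℤ, t ^ k = r → k = 1 ∨ k = -1) (hrt : r ∈ Subgroup.zpowers t) :
    Subgroup.zpowers t = Subgroup.zpowers r := by
  obtain ⟨k, hk⟩ := Subgroup.mem_zpowers_iff.1 hrt
  rcases hr k hk with rfl | rfl
  · rw [zpow_one] at hk; rw [hk]
  · rw [zpow_neg, zpow_one] at hk
    rw [← hk, Subgroup.zpowers_inv]

/-- Two commuting elements of a free group lie in a common cyclic subgroup.
[cite: LyndonSchupp2001, Ch. I Prop. 2.17] -/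
theorem FreeGroup.exists_mem_zpowers_of_commute {α : Type u} {x y : FreeGroup α}
    (h : Commute x y) : ∃ t : FreeGroup α, x ∈ Subgroup.zpowers t ∧ y ∈ Subgroup.zpowers t := by
  let K : Subgroup (FreeGroup α) := Subgroup.closure {x, y}
  have hk : ∀ a ∈ ({x, y} : Set (FreeGroup α)), ∀ b ∈ ({x, y} : Set (FreeGroup α)),
      a * b = b * a := by
    intro a ha b hb
    simp only [Set.mem_insert_iff, Set.mem_singleton_iff] at ha hb
    rcases ha with rfl | rfl <;> rcases hb with rfl | rfl
    · rfl
    · exact h.eq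
    · exact h.eq.symm
    · rfl
  haveI := Subgroup.isMulCommutative_closure hk
  have hK : ∀ a ∈ K, ∀ b ∈ K, a * b = b * a := fun a ha b hb =>
    congrArg Subtype.val (IsMulCommutative.is_comm.comm (⟨a, ha⟩ : K) ⟨b, hb⟩)
  obtain ⟨t, ht⟩ := (Subgroup.isCyclic_iff_exists_zpowers_eq_top K).1
    (FreeGroup.isCyclic_of_forall_commute K hK)
  refine ⟨t, ?_, ?_⟩
  · rw [ht]; exact Subgroup.subset_closure (by simp)
  · rw [ht]; exact Subgroup.subset_closure (by simp)

/-- The centralizer of a basis element `a` of a free group is `⟨a⟩`.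
[cite: LyndonSchupp2001, Ch. I Prop. 2.19] -/
theorem FreeGroup.centralizer_of_eq_zpowers {α : Type u} (a : α) :
    Subgroup.centralizer {FreeGroup.of a} = Subgroup.zpowers (FreeGroup.of a) := by
  refine le_antisymm ?_ ?_
  · intro z hz
    rw [Subgroup.mem_centralizer_singleton_iff] at hz
    obtain ⟨t, hzt, hat⟩ := FreeGroup.exists_mem_zpowers_of_commute (x := z) (y := FreeGroup.of a) hz
    rwa [zpowers_eq_zpowers_of_prim (fun k hk => FreeGroup.zpow_eq_of_iff a t k hk) hat] at hzt
  · intro z hz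
    rw [Subgroup.mem_centralizer_singleton_iff]
    obtain ⟨k, rfl⟩ := Subgroup.mem_zpowers_iff.1 hz
    exact (Commute.zpow_left (Commute.refl _) k).eq

/-! ### Centralizers are cyclic -/

/-- **A free group with a non-trivial central element is cyclic**: if two distinct basis elements
`a ≠ b` existed, the central element would be a non-zero power of `a` and of `b`.
[cite: MagnusKarrassSolitar1966, §1.4 Problem 6] -/
theorem IsFreeGroup.isCyclic_of_mem_center {H : Type u} [Group H] [IsFreeGroup H] {z : H}
    (hz : z ∈ Subgroup.center H) (hz1 : z ≠ 1) : IsCyclic H := by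
  classical
  refine IsFreeGroup.isCyclic_of_subsingleton_generators
    (Subsingleton.intro fun a b => Classical.byContradiction fun hab => hz1 ?_)
  let e := IsFreeGroup.toFreeGroup H
  have hea : ∀ c, e (IsFreeGroup.of c) = FreeGroup.of c := fun c => by
    simp [e, IsFreeGroup.toFreeGroup, IsFreeGroup.of]
  -- `e z` commutes with the letters `a` and `b`
  have hcomm : ∀ c, e z ∈ Subgroup.centralizer {FreeGroup.of c} := fun c => by
    rw [Subgroup.mem_centralizer_singleton_iff, ← hea, ← map_mul, ← map_mul,
      (Subgroup.mem_center_iff.1 hz (IsFreeGroup.of c))]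
  obtain ⟨i, hi⟩ := Subgroup.mem_zpowers_iff.1 ((FreeGroup.centralizer_of_eq_zpowers a) ▸ hcomm a)
  obtain ⟨j, hj⟩ := Subgroup.mem_zpowers_iff.1 ((FreeGroup.centralizer_of_eq_zpowers b) ▸ hcomm b)
  obtain ⟨σ, hσa, hσ⟩ := FreeGroup.exists_hom_of_eq_one (α := IsFreeGroup.Generators H) a
  have h1 := congrArg σ (hi.trans hj.symm)
  rw [map_zpow, map_zpow, hσa, hσ b (Ne.symm hab), one_zpow] at h1
  have h2 := congrArg Multiplicative.toAdd h1
  rw [toAdd_zpow, toAdd_ofAdd, smul_eq_mul, mul_one, toAdd_one] at h2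
  subst h2
  rw [zpow_zero] at hi
  exact e.injective (by rw [← hi, map_one])

/-- **The centralizer of a non-trivial element of a free group is cyclic** (it is free by
Nielsen–Schreier and has a non-trivial centre). [cite: LyndonSchupp2001, Ch. I Prop. 2.19] -/
theorem FreeGroup.isCyclic_centralizer {α : Type u} {z : FreeGroup α} (hz : z ≠ 1) :
    IsCyclic (Subgroup.centralizer ({z} : Set (FreeGroup α))) := by
  have hzC : z ∈ Subgroup.centralizer ({z} : Set (FreeGroup α)) :=
    Subgroup.mem_centralizer_singleton_iff.2 rfl
  refine IsFreeGroup.isCyclic_of_mem_center (z := ⟨z, hzC⟩) ?_ ?_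
  · rw [Subgroup.mem_center_iff]
    rintro ⟨g, hg⟩
    exact Subtype.ext (Subgroup.mem_centralizer_singleton_iff.1 hg)
  · exact fun h => hz (congrArg Subtype.val h)

/-- The centralizer of a non-trivial element of a free group is `⟨t⟩` for some `t`.
[cite: LyndonSchupp2001, Ch. I Prop. 2.19] -/
theorem FreeGroup.exists_centralizer_eq_zpowers {α : Type u} {z : FreeGroup α} (hz : z ≠ 1) :
    ∃ t : FreeGroup α, Subgroup.centralizer ({z} : Set (FreeGroup α)) = Subgroup.zpowers t := by
  obtain ⟨t, ht⟩ := (Subgroup.isCyclic_iff_exists_zpowers_eq_top _).1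
    (FreeGroup.isCyclic_centralizer hz)
  exact ⟨t, ht.symm⟩

/-- **`xᵐ = yⁿ` with `m, n ≠ 0` forces `x` and `y` to commute** (both centralize the common
power, whose centralizer is cyclic). [cite: LyndonSchupp2001, Ch. I Prop. 2.17] -/
theorem FreeGroup.commute_of_zpow_eq_zpow {α : Type u} {x y : FreeGroup α} {m n : ℤ} (hm : m ≠ 0)
    (hn : n ≠ 0) (h : x ^ m = y ^ n) : Commute x y := by
  by_cases hx : x = 1
  · subst hx
    rw [one_zpow, eq_comm, IsMulTorsionFree.zpow_eq_one_iff_left hn] at h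
    rw [h]
  have hw : x ^ m ≠ 1 := fun h1 => hx ((IsMulTorsionFree.zpow_eq_one_iff_left hm).1 h1)
  obtain ⟨t, ht⟩ := FreeGroup.exists_centralizer_eq_zpowers hw
  have hxt : x ∈ Subgroup.zpowers t := by
    rw [← ht, Subgroup.mem_centralizer_singleton_iff]; exact ((Commute.refl x).zpow_right m).eq
  have hyt : y ∈ Subgroup.zpowers t := by
    rw [← ht, Subgroup.mem_centralizer_singleton_iff, h]
    exact ((Commute.refl y).zpow_right n).eq
  obtain ⟨i, rfl⟩ := Subgroup.mem_zpowers_iff.1 hxt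
  obtain ⟨j, rfl⟩ := Subgroup.mem_zpowers_iff.1 hyt
  exact Commute.zpow_zpow (Commute.refl t) i j

/-- The `ℕ`-power form of "`r` is not a proper power" implies the `ℤ`-power form.
[cite: MagnusKarrassSolitar1966, §1.4 Problem 7] -/
theorem zpow_prim_of_pow_prim {G : Type u} [Group G] {r : G}
    (hr : ∀ (t : G) (k : ℕ), t ^ k = r → k = 1) (t : G) (k : ℤ) (h : t ^ k = r) :
    k = 1 ∨ k = -1 := by
  rcases Int.natAbs_eq k with hk | hk
  · left
    rw [hk, zpow_natCast] at h
    rw [hk, hr t _ h]; rfl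
  · right
    rw [hk, zpow_neg, zpow_natCast, ← inv_pow] at h
    rw [hk, hr _ _ h]; rfl

/-- An element which is not a proper power is not `1`. [cite: MagnusKarrassSolitar1966, §1.4 Problem 7] -/
theorem ne_one_of_pow_prim {G : Type u} [Group G] {r : G}
    (hr : ∀ (t : G) (k : ℕ), t ^ k = r → k = 1) : r ≠ 1 := by
  intro h
  have := hr 1 0 (by rw [pow_zero, h])
  exact absurd this (by decide)

/-- **`Z(rᵐ) = ⟨r⟩`** for `m ≠ 0` when `r` is not a proper power.
[cite: MagnusKarrassSolitar1966, Cor. 4.1.6] -/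
theorem FreeGroup.centralizer_zpow_eq_zpowers {α : Type u} {r : FreeGroup α}
    (hr : ∀ (t : FreeGroup α) (k : ℕ), t ^ k = r → k = 1) {m : ℤ} (hm : m ≠ 0) :
    Subgroup.centralizer ({r ^ m} : Set (FreeGroup α)) = Subgroup.zpowers r := by
  have hrm : r ^ m ≠ 1 := fun h =>
    ne_one_of_pow_prim hr ((IsMulTorsionFree.zpow_eq_one_iff_left hm).1 h)
  obtain ⟨t, ht⟩ := FreeGroup.exists_centralizer_eq_zpowers hrm
  have hrt : r ∈ Subgroup.zpowers t := by
    rw [← ht, Subgroup.mem_centralizer_singleton_iff]; exact ((Commute.refl r).zpow_right m).eq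
  rw [ht, zpowers_eq_zpowers_of_prim (zpow_prim_of_pow_prim hr t) hrt]

/-- **Malnormality of `⟨r⟩`** for `r` not a proper power: if `g ∉ ⟨r⟩` and `g rᵐ g⁻¹ ∈ ⟨r⟩`
then `m = 0`. [cite: MagnusKarrassSolitar1966, Cor. 4.1.6] -/
theorem FreeGroup.eq_zero_of_conj_zpow_mem_zpowers {α : Type u} {r g : FreeGroup α}
    (hr : ∀ (t : FreeGroup α) (k : ℕ), t ^ k = r → k = 1) (hg : g ∉ Subgroup.zpowers r) {m : ℤ}
    (h : g * r ^ m * g⁻¹ ∈ Subgroup.zpowers r) : m = 0 := by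
  by_contra hm
  have hr1 : r ≠ 1 := ne_one_of_pow_prim hr
  obtain ⟨n, hn⟩ := Subgroup.mem_zpowers_iff.1 h
  have hn0 : n ≠ 0 := by
    rintro rfl
    rw [zpow_zero, eq_comm, mul_inv_eq_one, mul_eq_left, IsMulTorsionFree.zpow_eq_one_iff_left hm]
      at hn
    exact hr1 hn
  -- `(g r g⁻¹)ᵐ = rⁿ`, so `g r g⁻¹` centralizes `r`, i.e. `g r g⁻¹ = r ^ b`
  have hconj : (g * r * g⁻¹) ^ m = r ^ n := by rw [conj_zpow, hn]
  have hc := FreeGroup.commute_of_zpow_eq_zpow hm hn0 hconj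
  have hmem : g * r * g⁻¹ ∈ Subgroup.zpowers r := by
    rw [← FreeGroup.centralizer_zpow_eq_zpowers hr one_ne_zero, zpow_one,
      Subgroup.mem_centralizer_singleton_iff]
    exact hc.eq
  obtain ⟨b, hb⟩ := Subgroup.mem_zpowers_iff.1 hmem
  -- `r = (g⁻¹ r g) ^ b`, so `b = ±1`
  have hb' : (g⁻¹ * r * g⁻¹⁻¹) ^ b = r := by
    rw [conj_zpow, hb]; group
  rcases zpow_prim_of_pow_prim hr _ _ hb' with rfl | rfl
  · -- `g` commutes with `r`
    rw [zpow_one] at hb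
    refine hg ?_
    rw [← FreeGroup.centralizer_zpow_eq_zpowers hr one_ne_zero, zpow_one,
      Subgroup.mem_centralizer_singleton_iff]
    calc g * r = g * r * g⁻¹ * g := by group
      _ = r * g := by rw [← hb]
  · -- `g r g⁻¹ = r⁻¹`: then `g²` centralizes `r`
    rw [zpow_neg, zpow_one] at hb
    have e1 : g * r * g⁻¹ = r⁻¹ := hb.symm
    have e2 : g * r⁻¹ * g⁻¹ = r :=
      calc g * r⁻¹ * g⁻¹ = (g * r * g⁻¹)⁻¹ := by group
        _ = r⁻¹⁻¹ := by rw [e1]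
        _ = r := inv_inv r
    have e3 : (g * g) * r * ((g * g))⁻¹ = r :=
      calc (g * g) * r * ((g * g))⁻¹ = g * (g * r * g⁻¹) * g⁻¹ := by group
        _ = g * r⁻¹ * g⁻¹ := by rw [e1]
        _ = r := e2
    have h2 : (g * g) ∈ Subgroup.zpowers r := by
      rw [← FreeGroup.centralizer_zpow_eq_zpowers hr one_ne_zero, zpow_one,
        Subgroup.mem_centralizer_singleton_iff]
      calc (g * g) * r = (g * g) * r * ((g * g))⁻¹ * (g * g) := by group
        _ = r * (g * g) := by rw [e3]
    obtain ⟨j, hj⟩ := Subgroup.mem_zpowers_iff.1 h2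
    by_cases hj0 : j = 0
    · subst hj0
      rw [zpow_zero, eq_comm, mul_eq_one_iff_eq_inv, ← mul_left_inj g, inv_mul_cancel, ← zpow_two,
        IsMulTorsionFree.zpow_eq_one_iff_left two_ne_zero] at hj
      exact hg (hj ▸ Subgroup.one_mem _)
    · -- `g` commutes with `g² = r ^ j`, but conjugates it to `r ^ (-j)`
      have e4 : g * r ^ j * g⁻¹ = r ^ (-j) := by rw [← conj_zpow, e1, inv_zpow']
      have e5 : g * r ^ j * g⁻¹ = r ^ j := by rw [hj]; group
      have e6 : r ^ (j + j) = 1 := by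
        rw [zpow_add]
        nth_rw 2 [← e5]
        rw [e4, ← zpow_add, add_neg_cancel, zpow_zero]
      have : j + j ≠ 0 := by omega
      exact hr1 ((IsMulTorsionFree.zpow_eq_one_iff_left this).1 e6)

end Literature.GroupTheory.CombinatorialGroupTheory
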